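import Summits.AtomisticToContinuum.FouriersLaw.Theorems.EmbeddedDrudeMourreFGRGapBootstrapC
import Mathlib.Analysis.Calculus.BumpFunction.Normed
import Mathlib.Analysis.Calculus.FDeriv.Analytic

/-!
# FGRGap, line fold-jet-rigidity, stub S2 (averaging bootstrap) — file L:
# the local smooth representative of a null vector

Support file for `stub_nullVectorRegularity` of crux `EmbeddedDrudeMourre.FGRGap`
(item stmt-AtomisticToContinuum-12595). Given the analytic local lifts `φ` of the partner map
with their implicit derivatives, a general-position resonance on every fibre, and the a.e.
four-point identity `f k₁ + f (h k₁ k₃) = f k₃ + f (k₁ + h k₁ k₃ - k₃)` for a `2π`-periodic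
locally integrable `f`, every `k₀` has a neighbourhood on which `f` agrees a.e. with a `C^∞`
function: average the identity against a smooth bump `χ (k₃)` centred at the general-position
partner and apply the core lemma (file C) to the two composed terms `f ∘ φ`, `f ∘ (k₁ + φ - k₃)`,
whose `k₃`-derivatives `(v₃-v₄)/(v₂-v₄)`, `(v₃-v₂)/(v₂-v₄)` do not vanish there.
-/

noncomputable section

open MeasureTheory Set Real Filter Topology Metric
open scoped ENNReal ContDiff
open Literature.MathematicalPhysics.KineticTheory.PhononBoltzmann
open Summit.AtomisticToContinuum.FouriersLaw.Theorems.FGRGap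

namespace Summit.AtomisticToContinuum.FouriersLaw.Theorems.FGRGap.FoldJetRigidity.Bootstrap

/-- Averaging a pointwise-in-`a`, a.e.-in-`y` identity against a bump: if `∫ χ = 1` and
`f a = F y` for a.e. `y` in the support window, then `f a = ∫ χ (y) F (y) dy`. -/
theorem eq_integral_bump_of_ae {χ F : ℝ → ℝ} {c : ℝ} (hχ1 : ∫ y, χ y = 1)
    {S : Set ℝ} (hχS : ∀ y ∉ S, χ y = 0) (h : ∀ᵐ y : ℝ, y ∈ S → c = F y) :
    c = ∫ y, χ y * F y := by
  calc c = (∫ y, χ y) * c := by rw [hχ1, one_mul]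
    _ = ∫ y, χ y * c := (integral_mul_const c _).symm
    _ = ∫ y, χ y * F y := by
      refine integral_congr_ae ?_
      filter_upwards [h] with y hy
      by_cases hyS : y ∈ S
      · rw [hy hyS]
      · rw [hχS y hyS, zero_mul, zero_mul]

/-- **The local smooth representative.** Let `h` admit analytic local lifts with the implicit
derivatives `∂₁φ = (v₄-v₁)/(v₂-v₄)`, `∂₃φ = (v₃-v₄)/(v₂-v₄)` near every point off the
equal-velocity curve, and a general-position resonance on every fibre. If `f` is `2π`-periodic,
locally integrable, and satisfies the four-point identity along `h` a.e. in the plane, then every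
`k₀ : ℝ` has `ε > 0` and a `C^∞` function `R` with `f = R` a.e. on `(k₀ - ε, k₀ + ε)`. -/
theorem exists_local_smooth_repr {ω₂ : ℝ} {h : ℝ → ℝ → ℝ}
    (h_lift : ∀ k₁ k₃ : ℝ, groupVelocity ω₂ k₃ ≠ groupVelocity ω₂ k₁ →
      ∃ (φ : ℝ × ℝ → ℝ) (U : Set (ℝ × ℝ)), U ∈ 𝓝 (k₁, k₃) ∧ AnalyticOnNhd ℝ φ U ∧
        φ (k₁, k₃) = h k₁ k₃ ∧ (∀ p ∈ U, ∃ n : ℤ, φ p = h p.1 p.2 + n * (2 * π)) ∧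
        (∀ p ∈ U, groupVelocity ω₂ p.2 ≠ groupVelocity ω₂ p.1) ∧
        (∀ p ∈ U, HasStrictFDerivAt φ
          (((groupVelocity ω₂ (p.1 + φ p - p.2) - groupVelocity ω₂ p.1) /
            (groupVelocity ω₂ (φ p) - groupVelocity ω₂ (p.1 + φ p - p.2))) •
              ContinuousLinearMap.fst ℝ ℝ ℝ +
          ((groupVelocity ω₂ p.2 - groupVelocity ω₂ (p.1 + φ p - p.2)) /
            (groupVelocity ω₂ (φ p) - groupVelocity ω₂ (p.1 + φ p - p.2))) •
              ContinuousLinearMap.snd ℝ ℝ ℝ) p))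
    (h_gen : ∀ k₁ r : ℝ, 0 ≤ r → ∃ k₃ : ℝ,
      groupVelocity ω₂ k₁ ≠ groupVelocity ω₂ (h k₁ k₃) ∧
      groupVelocity ω₂ k₁ ≠ groupVelocity ω₂ k₃ ∧
      groupVelocity ω₂ k₁ ≠ groupVelocity ω₂ (k₁ + h k₁ k₃ - k₃) ∧
      groupVelocity ω₂ (h k₁ k₃) ≠ groupVelocity ω₂ k₃ ∧
      groupVelocity ω₂ (h k₁ k₃) ≠ groupVelocity ω₂ (k₁ + h k₁ k₃ - k₃) ∧
      groupVelocity ω₂ k₃ ≠ groupVelocity ω₂ (k₁ + h k₁ k₃ - k₃) ∧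
      vertex 1 r k₁ (h k₁ k₃) k₃ ≠ 0)
    {f : ℝ → ℝ} (hf_per : Function.Periodic f (2 * π)) (hf_loc : LocallyIntegrable f volume)
    (hae : ∀ᵐ p : ℝ × ℝ, f p.1 + f (h p.1 p.2) = f p.2 + f (p.1 + h p.1 p.2 - p.2)) (k₀ : ℝ) :
    ∃ ε : ℝ, 0 < ε ∧ ∃ R : ℝ → ℝ, ContDiff ℝ ∞ R ∧
      ∀ᵐ a : ℝ, a ∈ Ioo (k₀ - ε) (k₀ + ε) → f a = R a := by
  -- a general-position partner on the fibre of `k₀` and the lift there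
  obtain ⟨k₃, hv12, hv13, hv14, hv23, hv24, hv34, -⟩ := h_gen k₀ 0 le_rfl
  obtain ⟨φ, U, hU, hφ, hφ0, hlift, hcurve, hder⟩ := h_lift k₀ k₃ hv13.symm
  set V : Set (ℝ × ℝ) := interior U with hV
  have hVo : IsOpen V := isOpen_interior
  have hp₀V : (k₀, k₃) ∈ V := mem_interior_iff_mem_nhds.2 hU
  have hVU : V ⊆ U := interior_subset
  have hφV : ContDiffOn ℝ ∞ φ V := (hφ.mono hVU).contDiffOn hVo.uniqueDiffOn
  set κ : ℝ × ℝ → ℝ := fun p => p.1 + φ p - p.2 with hκ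
  have hκV : ContDiffOn ℝ ∞ κ V := (contDiffOn_fst.add hφV).sub contDiffOn_snd
  -- the `k₃`-derivatives at `p₀`
  set A : ℝ := (groupVelocity ω₂ (k₀ + h k₀ k₃ - k₃) - groupVelocity ω₂ k₀) /
    (groupVelocity ω₂ (h k₀ k₃) - groupVelocity ω₂ (k₀ + h k₀ k₃ - k₃)) with hA
  set B : ℝ := (groupVelocity ω₂ k₃ - groupVelocity ω₂ (k₀ + h k₀ k₃ - k₃)) /
    (groupVelocity ω₂ (h k₀ k₃) - groupVelocity ω₂ (k₀ + h k₀ k₃ - k₃)) with hB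
  have hderφ : HasFDerivAt φ (A • ContinuousLinearMap.fst ℝ ℝ ℝ +
      B • ContinuousLinearMap.snd ℝ ℝ ℝ) (k₀, k₃) := by
    have := (hder (k₀, k₃) (mem_of_mem_nhds hU)).hasFDerivAt
    rw [hφ0] at this
    exact this
  have hderκ : HasFDerivAt κ (ContinuousLinearMap.fst ℝ ℝ ℝ +
      (A • ContinuousLinearMap.fst ℝ ℝ ℝ + B • ContinuousLinearMap.snd ℝ ℝ ℝ) -
      ContinuousLinearMap.snd ℝ ℝ ℝ) (k₀, k₃) :=
    (hasFDerivAt_fst.add hderφ).sub hasFDerivAt_snd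
  have hden : groupVelocity ω₂ (h k₀ k₃) - groupVelocity ω₂ (k₀ + h k₀ k₃ - k₃) ≠ 0 :=
    sub_ne_zero.2 hv24
  have h2φ : fderiv ℝ φ (k₀, k₃) (0, 1) ≠ 0 := by
    rw [hderφ.fderiv]
    simp only [add_apply, FunLike.coe_smul, Pi.smul_apply,
      ContinuousLinearMap.coe_fst', ContinuousLinearMap.coe_snd', smul_eq_mul, mul_zero,
      zero_add, mul_one]
    rw [hB]
    exact div_ne_zero (sub_ne_zero.2 hv34) hden
  have h2κ : fderiv ℝ κ (k₀, k₃) (0, 1) ≠ 0 := by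
    rw [hderκ.fderiv]
    simp only [sub_apply, add_apply, FunLike.coe_smul, Pi.smul_apply,
      ContinuousLinearMap.coe_fst', ContinuousLinearMap.coe_snd', smul_eq_mul, mul_zero,
      zero_add, mul_one]
    rw [hB]
    rw [div_sub_one hden]
    refine div_ne_zero ?_ hden
    intro h0
    exact hv23 (by linarith)
  -- the core lemma for the two composed terms
  obtain ⟨ε₁, hε₁, hC₁⟩ := exists_smooth_repr_integral_comp φ (k₀, k₃) V hVo hp₀V hφV h2φ
  obtain ⟨ε₂, hε₂, hC₂⟩ := exists_smooth_repr_integral_comp κ (k₀, k₃) V hVo hp₀V hκV h2κ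
  -- a box inside `V`
  obtain ⟨δ, hδ, hδV⟩ := Metric.isOpen_iff.1 hVo (k₀, k₃) hp₀V
  set ε : ℝ := min (min ε₁ ε₂) δ with hε_def
  have hε : 0 < ε := lt_min (lt_min hε₁ hε₂) hδ
  have hε1 : ε ≤ ε₁ := (min_le_left _ _).trans (min_le_left _ _)
  have hε2 : ε ≤ ε₂ := (min_le_left _ _).trans (min_le_right _ _)
  have hεδ : ε ≤ δ := min_le_right _ _
  -- the bump in `k₃`
  let β : ContDiffBump (k₃ : ℝ) := ⟨ε / 4, ε / 2, by positivity, by linarith⟩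
  have hrOut : β.rOut = ε / 2 := rfl
  set χ : ℝ → ℝ := β.normed volume with hχ_def
  have hχs : tsupport χ = closedBall k₃ (ε / 2) := by rw [hχ_def, β.tsupport_normed_eq, hrOut]
  have hχsub : ∀ {η : ℝ}, ε ≤ η → tsupport χ ⊆ Ioo (((k₀, k₃) : ℝ × ℝ).2 - η) (((k₀, k₃) : ℝ × ℝ).2 + η) := by
    intro η hη
    rw [hχs, Real.closedBall_eq_Icc]
    intro y hy
    exact ⟨by dsimp only; linarith [hy.1], by dsimp only; linarith [hy.2]⟩
  have hχc : HasCompactSupport χ := β.hasCompactSupport_normed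
  have hχd : ContDiff ℝ ∞ χ := β.contDiff_normed
  have hχ1 : ∫ y, χ y = 1 := β.integral_normed
  have hχ0 : ∀ y ∉ Ioo (k₃ - ε) (k₃ + ε), χ y = 0 := fun y hy =>
    image_eq_zero_of_notMem_tsupport fun h' => hy (hχsub le_rfl h')
  obtain ⟨hI₁, R₁, hR₁, hR₁eq⟩ := hC₁ χ hχd hχc (hχsub hε1) f hf_loc
  obtain ⟨hI₂, R₂, hR₂, hR₂eq⟩ := hC₂ χ hχd hχc (hχsub hε2) f hf_loc
  have hI₀ : Integrable (fun y => χ y * f y) :=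
    hf_loc.integrable_smul_left_of_hasCompactSupport hχd.continuous hχc
  -- the representative
  refine ⟨ε, hε, fun a => (∫ y, χ y * f y) + R₂ a - R₁ a,
    (contDiff_const.add hR₂).sub hR₁, ?_⟩
  have hae' : ∀ᵐ a : ℝ, ∀ᵐ y : ℝ, f a + f (h a y) = f y + f (a + h a y - y) := by
    have h' := hae
    rw [Measure.volume_eq_prod] at h'
    exact Measure.ae_ae_of_ae_prod h'
  filter_upwards [hae'] with a ha haI
  have ha1 : a ∈ Ioo (((k₀, k₃) : ℝ × ℝ).1 - ε₁) (((k₀, k₃) : ℝ × ℝ).1 + ε₁) :=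
    ⟨by dsimp only; linarith [haI.1], by dsimp only; linarith [haI.2]⟩
  have ha2 : a ∈ Ioo (((k₀, k₃) : ℝ × ℝ).1 - ε₂) (((k₀, k₃) : ℝ × ℝ).1 + ε₂) :=
    ⟨by dsimp only; linarith [haI.1], by dsimp only; linarith [haI.2]⟩
  -- on the support window the lift is `h` up to `2πℤ`
  have hwin : ∀ y ∈ Ioo (k₃ - ε) (k₃ + ε), (a, y) ∈ U := by
    intro y hy
    apply hVU; apply hδV
    rw [← ball_prod_same]
    refine ⟨?_, ?_⟩
    · show a ∈ ball k₀ δ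
      rw [Real.ball_eq_Ioo]
      exact ⟨by linarith [haI.1], by linarith [haI.2]⟩
    · show y ∈ ball k₃ δ
      rw [Real.ball_eq_Ioo]
      exact ⟨by linarith [hy.1], by linarith [hy.2]⟩
  have hid : f a = ∫ y, χ y * (f y + f (κ (a, y)) - f (φ (a, y))) := by
    refine eq_integral_bump_of_ae hχ1 hχ0 ?_
    filter_upwards [ha] with y hy hyw
    obtain ⟨n, hn⟩ := hlift (a, y) (hwin y hyw)
    have e1 : f (φ (a, y)) = f (h a y) := by rw [hn]; exact hf_per.int_mul n _
    have e2 : f (κ (a, y)) = f (a + h a y - y) := by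
      simp only [hκ, hn]
      rw [show a + (h a y + n * (2 * π)) - y = a + h a y - y + n * (2 * π) by ring]
      exact hf_per.int_mul n _
    rw [e1, e2]
    linarith
  rw [hid, hR₁eq a ha1, hR₂eq a ha2]
  have hI₁a := hI₁ a ha1
  have hI₂a := hI₂ a ha2
  have hsplit : (fun y => χ y * (f y + f (κ (a, y)) - f (φ (a, y)))) =
      fun y => (χ y * f y + χ y * f (κ (a, y))) - χ y * f (φ (a, y)) := by
    funext y; ring
  have e1 : (∫ y, (χ y * f y + χ y * f (κ (a, y))) - χ y * f (φ (a, y))) =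
      (∫ y, (χ y * f y + χ y * f (κ (a, y)))) - ∫ y, χ y * f (φ (a, y)) :=
    integral_sub (hI₀.add hI₂a) hI₁a
  have e2 : (∫ y, (χ y * f y + χ y * f (κ (a, y)))) =
      (∫ y, χ y * f y) + ∫ y, χ y * f (κ (a, y)) := integral_add hI₀ hI₂a
  rw [hsplit, e1, e2]

end Summit.AtomisticToContinuum.FouriersLaw.Theorems.FGRGap.FoldJetRigidity.Bootstrap

namespace Summit.AtomisticToContinuum.FouriersLaw.Theorems.FGRGap.FoldJetRigidity

/-- **Helper stub L of `stub_nullVectorRegularity` (line fold-jet-rigidity): the local smooth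
representative.** Given the analytic local lifts of the partner map with their implicit
derivatives off the equal-velocity curve and a general-position resonance on every fibre, a
`2π`-periodic locally integrable `f` satisfying the four-point identity a.e. in the plane agrees,
near every `k₀`, a.e. with a `C^∞` function (average against a bump in `k₃` at the
general-position partner; the core lemma C for `f ∘ φ` and `f ∘ (k₁ + φ - k₃)`). -/
theorem stub_nullVectorRegularity_partL :
    ∀ ω₂ : ℝ, ∀ h : ℝ → ℝ → ℝ, (∀ k₁ k₃ : ℝ, groupVelocity ω₂ k₃ ≠ groupVelocity ω₂ k₁ → ∃ (φ : ℝ × ℝ → ℝ) (U : Set (ℝ × ℝ)), U ∈ 𝓝 (k₁, k₃) ∧ AnalyticOnNhd ℝ φ U ∧ φ (k₁, k₃) = h k₁ k₃ ∧ (∀ p ∈ U, ∃ n : ℤ, φ p = h p.1 p.2 + n * (2 * π)) ∧ (∀ p ∈ U, groupVelocity ω₂ p.2 ≠ groupVelocity ω₂ p.1) ∧ (∀ p ∈ U, HasStrictFDerivAt φ (((groupVelocity ω₂ (p.1 + φ p - p.2) - groupVelocity ω₂ p.1) / (groupVelocity ω₂ (φ p) - groupVelocity ω₂ (p.1 + φ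 p - p.2))) • ContinuousLinearMap.fst ℝ ℝ ℝ + ((groupVelocity ω₂ p.2 - groupVelocity ω₂ (p.1 + φ p - p.2)) / (groupVelocity ω₂ (φ p) - groupVelocity ω₂ (p.1 + φ p - p.2))) • ContinuousLinearMap.snd ℝ ℝ ℝ) p)) → (∀ k₁ r : ℝ, 0 ≤ r → ∃ k₃ : ℝ, groupVelocity ω₂ k₁ ≠ groupVelocity ω₂ (h k₁ k₃) ∧ groupVelocity ω₂ k₁ ≠ groupVelocity ω₂ k₃ ∧ groupVelocity ω₂ k₁ ≠ groupVelocity ω₂ (k₁ + h k₁ k₃ - k₃) ∧ groupVelocity ω₂ (h k₁ k₃) ≠ groupVelocity ω₂ k₃ ∧ groupVelocity ω₂ (h k₁ k₃) ≠ groupVelocity ω₂ (k₁ + h k₁ k₃ - k₃) ∧ groupVelocity ω₂ k₃ ≠ groupVelocity ω₂ (k₁ + h k₁ k₃ - k₃) ∧ vertex 1 r k₁ (h k₁ k₃) k₃ ≠ 0) → ∀ f : ℝ → ℝ, Function.Periodic f (2 * π) → MeasureTheory.LocallyIntegrable f MeasureTheory.volume → (∀ᵐ p : ℝ × ℝ,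 f p.1 + f (h p.1 p.2) = f p.2 + f (p.1 + h p.1 p.2 - p.2)) → ∀ k₀ : ℝ, ∃ ε : ℝ, 0 < ε ∧ ∃ R : ℝ → ℝ, ContDiff ℝ ((⊤ : ℕ∞) : WithTop ℕ∞) R ∧ ∀ᵐ a : ℝ, a ∈ Set.Ioo (k₀ - ε) (k₀ + ε) → f a = R a :=
  fun _ω₂ _h h_lift h_gen _f hf_per hf_loc hae k₀ =>
    Bootstrap.exists_local_smooth_repr h_lift h_gen hf_per hf_loc hae k₀

end Summit.AtomisticToContinuum.FouriersLaw.Theorems.FGRGap.FoldJetRigidity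

end
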